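import Summits.RiemannHypothesis.RiemannHypothesis.Theorems.Splittings.DbnBridgeKiUniform
import HarnessLib

/-!
# RiemannHypothesis / Splittings — the converse `FOZ ⟹ KiUniform` with the count law in MULTIPLICITY currency
(RAW zero-def delta to `Theorems/Splittings/DbnBridgeKiUniform.lean`; cell rh-split, seat (dbn, bridge) gen 4, card §10)

Cell rh-split, seat rh-split-dbn-bridge g4 (planner-rh-split-dbn-bridge-g4-0), 2026-08-26; raw-ified (the three Props
`DistinctMono` / `MultMono` / `NonrealZerosSimple` written out) and filed by rh-split-typer-2 g2 (owner of p467782) from the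
seat's `DbnBridgeG4Mult.lean` (sha16 fdf49975e93783d3; typer H1 rc 0 / 0 warnings / 0 sorry, std axioms on
`kiUniform_iff_cofinite_mult`). Nothing here bears on the truth of RH.

ERRATUM to §8 / `Theorems/Splittings/DbnBridgeKiUniform.lean` (`kiUniform_of_cofinite (hmono)`): the hypothesis
`hmono` there is count monotonicity in DISTINCT-zero (`Finset.card`) currency. The classical universal-factor
law (de Bruijn 1950; Craven–Csordas 1989; Csordas–Smith–Varga 1994; Ki–Kim–Lee 2009) counts non-real zeros
WITH MULTIPLICITY; in distinct currency the law is false for the Gaussian flow as a class statement (companion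
toy `DbnBridgeG4CountToy.lean`: `e^{-tD²}(z²+1)²` has 2, then 4, then 0 distinct non-real zeros), and for `H_t`
itself the distinct statement is OPEN (RH-implied: `distinctMono_of_rh` below).

This file re-types the hypothesis faithfully, with Mathlib's `analyticOrderNatAt` (order of vanishing):

* `one_le_analyticOrderNatAt_deBruijnH` — at a zero of `H_t` the order of vanishing is `≥ 1` (`H_t ≢ 0`).
* `kiUniform_of_cofinite_mult` — **FOZ ⟹ KiUniform modulo the MULTIPLICITY count law `hmult`**:
  `hmult : ∀ 0 ≤ t ≤ t', ∀ S' (finite set of non-real zeros of H_{t'}), ∃ S (finite set of non-real zeros of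
  H_t), Σ_{z ∈ S'} ord(H_{t'}, z) ≤ Σ_{z ∈ S} ord(H_t, z)` — a finitary rendering implied by the classical law
  `Z_c(e^{-tD²} f) ≤ Z_c(f)` (and trivially true when `H_t` has infinitely many non-real zeros).
* `kiUniform_iff_cofinite_mult` — the g2 headline with the hypothesis correctly typed.
* `distinctMono_of_mult_of_simple` — the landed distinct-currency `hmono` follows from `hmult` PLUS simplicity
  of every non-real zero of every `H_t`, `t ≥ 0` (unknown off RH); `distinctMono_of_rh`, `multMono_of_rh` —
  both hypotheses are RH-implied (vacuous under RH), hence not cheaply refutable.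

HONEST LABEL: SPLITTING SEARCH over kernel-typed RH-EQUIVALENCES; a splitting A ∧ B ⟹ RH is CONDITIONAL
bookkeeping unless A and B are both proved; nothing here bears on the truth of RH.
-/

noncomputable section

set_option linter.dupNamespace false

open Complex Set Filter Metric Topology

namespace Summit.RiemannHypothesis.RiemannHypothesis.Theorems.Splittings.DbnBridgeKiUniformMult

open Literature.NumberTheory.LFunctions
open Summit.RiemannHypothesis.RiemannHypothesis.Theses.RuelleBand
open Summit.RiemannHypothesis.Cruxes.CofiniteCriticalLine.Negative
open Summit.RiemannHypothesis.RiemannHypothesis.Theorems.Splittings.DbnBridgeKiUniform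

/-! ## 1. Orders of vanishing of `H_t` are finite and `≥ 1` at zeros -/

/-- `H_t` is analytic at every point. [folklore] -/
theorem analyticAt_deBruijnH (t : ℝ) (z : ℂ) : AnalyticAt ℂ (deBruijnH t) z :=
  (differentiable_deBruijnH_holds t).analyticAt z

/-- `H_t ≢ 0`, so its order of vanishing is finite everywhere. [folklore] -/
theorem analyticOrderAt_deBruijnH_ne_top (t : ℝ) (z : ℂ) : analyticOrderAt (deBruijnH t) z ≠ ⊤ := by
  intro htop
  have hzero : deBruijnH t = 0 :=
    (AnalyticOnNhd.analyticOrderAt_eq_top_iff_eq_zero z (analyticAt_deBruijnH t)).1 htop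
  exact deBruijnH_apply_zero_ne_zero t (by simp [hzero])

/-- At a zero of `H_t` the order of vanishing is at least `1`. [folklore] -/
theorem one_le_analyticOrderNatAt_deBruijnH {t : ℝ} {z : ℂ} (hz : deBruijnH t z = 0) :
    1 ≤ analyticOrderNatAt (deBruijnH t) z := by
  have hne0 : analyticOrderAt (deBruijnH t) z ≠ 0 :=
    (analyticAt_deBruijnH t z).analyticOrderAt_ne_zero.2 hz
  have hnetop := analyticOrderAt_deBruijnH_ne_top t z
  have hnat : (analyticOrderNatAt (deBruijnH t) z : ℕ∞) = analyticOrderAt (deBruijnH t) z :=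
    Nat.cast_analyticOrderNatAt hnetop
  by_contra hlt
  have h0 : analyticOrderNatAt (deBruijnH t) z = 0 := by omega
  apply hne0
  rw [← hnat, h0]
  simp

/-- A finite set of zeros of `H_t` has at most `Σ ord` elements. [folklore] -/
theorem card_le_sum_analyticOrderNatAt {t : ℝ} {S : Finset ℂ} (hS : ∀ z ∈ S, deBruijnH t z = 0) :
    S.card ≤ ∑ z ∈ S, analyticOrderNatAt (deBruijnH t) z := by
  rw [Finset.card_eq_sum_ones]
  exact Finset.sum_le_sum fun z hz => one_le_analyticOrderNatAt_deBruijnH (hS z hz)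

/-! ## 2. FOZ ⟹ KiUniform modulo the MULTIPLICITY count law -/

/-- **FOZ ⟹ KiUniform, modulo `MultMono`.** FOZ gives a reality threshold `T` for `H_0`
(`cofiniteCriticalLine_iff_kiKimLee_at_zero`); the non-real zeros of `H_0` form a finite set `Z₀`
(`finite_setOf_deBruijnH_zero_abs_re_lt`); put `M := Σ_{z ∈ Z₀} ord(H_0, z)`. For `t > 0` and a finite set
`S'` of non-real zeros of `H_t`: `card S' ≤ Σ_{S'} ord(H_t) ≤ Σ_S ord(H_0) ≤ M`. [folklore] -/
theorem kiUniform_of_cofinite_mult (hmult : (∀ t t' : ℝ, 0 ≤ t → t ≤ t' → ∀ S' : Finset ℂ, (∀ z ∈ S', deBruijnH t' z = 0 ∧ z.im ≠ 0) →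
      ∃ S : Finset ℂ, (∀ z ∈ S, deBruijnH t z = 0 ∧ z.im ≠ 0) ∧
        ∑ z ∈ S', analyticOrderNatAt (deBruijnH t') z ≤ ∑ z ∈ S, analyticOrderNatAt (deBruijnH t) z)) (h : CofiniteCriticalLine) :
    ∃ M : ℕ, ∀ t : ℝ, 0 < t → ∀ S : Finset ℂ, (∀ z ∈ S, deBruijnH t z = 0 ∧ z.im ≠ 0) → S.card ≤ M := by
  obtain ⟨T, hT⟩ := cofiniteCriticalLine_iff_kiKimLee_at_zero.1 h
  have hfin : {z : ℂ | deBruijnH 0 z = 0 ∧ z.im ≠ 0}.Finite :=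
    (finite_setOf_deBruijnH_zero_abs_re_lt le_rfl T).subset fun z hz =>
      ⟨hz.1, not_le.1 fun hle => hz.2 (hT z hz.1 hle)⟩
  refine ⟨∑ z ∈ hfin.toFinset, analyticOrderNatAt (deBruijnH 0) z, fun t ht S' hS' => ?_⟩
  obtain ⟨S, hS, hle⟩ := hmult 0 t le_rfl ht.le S' hS'
  have hsub : S ⊆ hfin.toFinset := fun z hz => hfin.mem_toFinset.2 (hS z hz)
  calc S'.card ≤ ∑ z ∈ S', analyticOrderNatAt (deBruijnH t) z :=
        card_le_sum_analyticOrderNatAt fun z hz => (hS' z hz).1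
    _ ≤ ∑ z ∈ S, analyticOrderNatAt (deBruijnH 0) z := hle
    _ ≤ ∑ z ∈ hfin.toFinset, analyticOrderNatAt (deBruijnH 0) z :=
        Finset.sum_le_sum_of_subset_of_nonneg hsub fun _ _ _ => Nat.zero_le _

/-- **KiUniform ⟺ FOZ, modulo `MultMono`** — the g2 headline with the classical fact correctly typed
(kernel ⟹ is `cofiniteCriticalLine_of_kiUniform`, hypothesis-free). [folklore] -/
theorem kiUniform_iff_cofinite_mult (hmult : (∀ t t' : ℝ, 0 ≤ t → t ≤ t' → ∀ S' : Finset ℂ, (∀ z ∈ S', deBruijnH t' z = 0 ∧ z.im ≠ 0) →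
      ∃ S : Finset ℂ, (∀ z ∈ S, deBruijnH t z = 0 ∧ z.im ≠ 0) ∧
        ∑ z ∈ S', analyticOrderNatAt (deBruijnH t') z ≤ ∑ z ∈ S, analyticOrderNatAt (deBruijnH t) z)) :
    (∃ M : ℕ, ∀ t : ℝ, 0 < t → ∀ S : Finset ℂ, (∀ z ∈ S, deBruijnH t z = 0 ∧ z.im ≠ 0) → S.card ≤ M) ↔
      CofiniteCriticalLine :=
  ⟨cofiniteCriticalLine_of_kiUniform, kiUniform_of_cofinite_mult hmult⟩

/-! ## 3. Labels: how the two currencies relate, and why neither is cheaply refutable -/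

/-- The landed distinct-currency hypothesis follows from the multiplicity law PLUS simplicity of all non-real
zeros of all `H_t`, `t ≥ 0`. [folklore] -/
theorem distinctMono_of_mult_of_simple (hmult : (∀ t t' : ℝ, 0 ≤ t → t ≤ t' → ∀ S' : Finset ℂ, (∀ z ∈ S', deBruijnH t' z = 0 ∧ z.im ≠ 0) →
      ∃ S : Finset ℂ, (∀ z ∈ S, deBruijnH t z = 0 ∧ z.im ≠ 0) ∧
        ∑ z ∈ S', analyticOrderNatAt (deBruijnH t') z ≤ ∑ z ∈ S, analyticOrderNatAt (deBruijnH t) z)) (hsimple : (∀ t : ℝ, 0 ≤ t → ∀ z : ℂ, deBruijnH t z = 0 → z.im ≠ 0 → analyticOrderNatAt (deBruijnH t) z = 1)) : (∀ t t' : ℝ, 0 ≤ t → t ≤ t' → ∀ S' : Finset ℂ, (∀ z ∈ S', deBruijnH t' z = 0 ∧ z.im ≠ 0) →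
      ∃ S : Finset ℂ, (∀ z ∈ S, deBruijnH t z = 0 ∧ z.im ≠ 0) ∧ S'.card ≤ S.card) := by
  intro t t' ht htt' S' hS'
  obtain ⟨S, hS, hle⟩ := hmult t t' ht htt' S' hS'
  refine ⟨S, hS, ?_⟩
  have h1 : ∑ z ∈ S', analyticOrderNatAt (deBruijnH t') z = S'.card := by
    rw [Finset.card_eq_sum_ones]
    exact Finset.sum_congr rfl fun z hz => hsimple t' (ht.trans htt') z (hS' z hz).1 (hS' z hz).2
  have h2 : ∑ z ∈ S, analyticOrderNatAt (deBruijnH t) z = S.card := by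
    rw [Finset.card_eq_sum_ones]
    exact Finset.sum_congr rfl fun z hz => hsimple t ht z (hS z hz).1 (hS z hz).2
  rw [← h1, ← h2]; exact hle

/-- Under RH every `H_t`, `t ≥ 0`, has only real zeros. [folklore] -/
theorem hasOnlyRealZeros_of_rh (hRH : _root_.RiemannHypothesis) {t : ℝ} (ht : 0 ≤ t) :
    HasOnlyRealZeros (deBruijnH t) :=
  mono_deBruijnH_holds ht (riemannHypothesis_iff_hasOnlyRealZeros_deBruijnH_zero_holds.1 hRH)

/-- RH ⟹ the distinct-currency hypothesis (vacuously: no non-real zeros for `t ≥ 0`) — so the landed `hmono`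
is RH-IMPLIED and not cheaply refutable; it is NOT a classical theorem. [folklore] -/
theorem distinctMono_of_rh (hRH : _root_.RiemannHypothesis) : (∀ t t' : ℝ, 0 ≤ t → t ≤ t' → ∀ S' : Finset ℂ, (∀ z ∈ S', deBruijnH t' z = 0 ∧ z.im ≠ 0) →
      ∃ S : Finset ℂ, (∀ z ∈ S, deBruijnH t z = 0 ∧ z.im ≠ 0) ∧ S'.card ≤ S.card) := by
  intro t t' ht htt' S' hS'
  have hreal := hasOnlyRealZeros_of_rh hRH (ht.trans htt')
  have hempty : S' = ∅ :=
    Finset.eq_empty_of_forall_notMem fun z hz => (hS' z hz).2 (hreal z (hS' z hz).1)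
  exact ⟨∅, by simp, by simp [hempty]⟩

/-- RH ⟹ the multiplicity-currency hypothesis (vacuously). [folklore] -/
theorem multMono_of_rh (hRH : _root_.RiemannHypothesis) : (∀ t t' : ℝ, 0 ≤ t → t ≤ t' → ∀ S' : Finset ℂ, (∀ z ∈ S', deBruijnH t' z = 0 ∧ z.im ≠ 0) →
      ∃ S : Finset ℂ, (∀ z ∈ S, deBruijnH t z = 0 ∧ z.im ≠ 0) ∧
        ∑ z ∈ S', analyticOrderNatAt (deBruijnH t') z ≤ ∑ z ∈ S, analyticOrderNatAt (deBruijnH t) z) := by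
  intro t t' ht htt' S' hS'
  have hreal := hasOnlyRealZeros_of_rh hRH (ht.trans htt')
  have hempty : S' = ∅ :=
    Finset.eq_empty_of_forall_notMem fun z hz => (hS' z hz).2 (hreal z (hS' z hz).1)
  exact ⟨∅, by simp, by simp [hempty]⟩

/-- RH ⟹ simplicity of non-real zeros (vacuously). [folklore] -/
theorem nonrealZerosSimple_of_rh (hRH : _root_.RiemannHypothesis) : (∀ t : ℝ, 0 ≤ t → ∀ z : ℂ, deBruijnH t z = 0 → z.im ≠ 0 → analyticOrderNatAt (deBruijnH t) z = 1) := by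
  intro t ht z hz him
  exact absurd (hasOnlyRealZeros_of_rh hRH ht z hz) him

/-- Only the endpoint `t = 0` of the count law is used by the converse: the ONE-TIME multiplicity law
`Z_c(H_t) ≤ Z_c(H_0)` for `t > 0` suffices. [folklore] -/
theorem kiUniform_of_cofinite_mult₀
    (hmult₀ : ∀ t : ℝ, 0 < t → ∀ S' : Finset ℂ, (∀ z ∈ S', deBruijnH t z = 0 ∧ z.im ≠ 0) →
      ∃ S : Finset ℂ, (∀ z ∈ S, deBruijnH 0 z = 0 ∧ z.im ≠ 0) ∧
        ∑ z ∈ S', analyticOrderNatAt (deBruijnH t) z ≤ ∑ z ∈ S, analyticOrderNatAt (deBruijnH 0) z)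
    (h : CofiniteCriticalLine) :
    ∃ M : ℕ, ∀ t : ℝ, 0 < t → ∀ S : Finset ℂ, (∀ z ∈ S, deBruijnH t z = 0 ∧ z.im ≠ 0) → S.card ≤ M := by
  obtain ⟨T, hT⟩ := cofiniteCriticalLine_iff_kiKimLee_at_zero.1 h
  have hfin : {z : ℂ | deBruijnH 0 z = 0 ∧ z.im ≠ 0}.Finite :=
    (finite_setOf_deBruijnH_zero_abs_re_lt le_rfl T).subset fun z hz =>
      ⟨hz.1, not_le.1 fun hle => hz.2 (hT z hz.1 hle)⟩
  refine ⟨∑ z ∈ hfin.toFinset, analyticOrderNatAt (deBruijnH 0) z, fun t ht S' hS' => ?_⟩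
  obtain ⟨S, hS, hle⟩ := hmult₀ t ht S' hS'
  have hsub : S ⊆ hfin.toFinset := fun z hz => hfin.mem_toFinset.2 (hS z hz)
  calc S'.card ≤ ∑ z ∈ S', analyticOrderNatAt (deBruijnH t) z :=
        card_le_sum_analyticOrderNatAt fun z hz => (hS' z hz).1
    _ ≤ ∑ z ∈ S, analyticOrderNatAt (deBruijnH 0) z := hle
    _ ≤ ∑ z ∈ hfin.toFinset, analyticOrderNatAt (deBruijnH 0) z :=
        Finset.sum_le_sum_of_subset_of_nonneg hsub fun _ _ _ => Nat.zero_le _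


end Summit.RiemannHypothesis.RiemannHypothesis.Theorems.Splittings.DbnBridgeKiUniformMult
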